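import Mathlib
import HarnessLib
import HarnessLib.Audit
import Summits.CriticalPhenomena.Statement
import Literature.Probability.RandomPlanarGeometry.HullSubdomainPullback
import Summits.CriticalPhenomena.SAWScalingLimit.Theorems.SAWLoopFugacityFlowSLECarrier
import Summits.CriticalPhenomena.SAWScalingLimit.Theorems.SAWLoopFugacityFlowAssembly
import Summits.CriticalPhenomena.SAWScalingLimit.Theorems.SAWLoopFugacityFlowAvoidanceDeterminesLaw
import HarnessLib.Audit.Status.Attr

/-!
Route: SAWSteinDefect

DORMANT since 2026-08-26T03:37:38Z (reconciler: no traction for 8.3 d (last activity statement-attached at 2026-08-17T19:22:02Z); parked, not closed — `ledger route dormant route-CriticalPhenomena-SAWSteinDefect --off` to reactivate) — unstaffed, not closed; items shared with open routes are served there. `ledger route dormant <id> --off` reactivates.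

# Route SAWSteinDefect — Stein's method at kappa = 8/3 — the 5/8-law error is an exact sum of
one-step defects of the excursion value function along the walk; balance constant 3/16 = 1/(2 kappa)

It suffices to show X = (V) ∧ (B) ∧ (R) ∧ (T) ∧ (S), realising idea card
stein-restriction-defect-tomography ("Stein's method at κ = 8/3:
restriction makes the SLE value functions explicit, so the 5/8-law error is an exact sum of one-step
kernel defects along the walk").
Fix a Dobrushin domain (D; a, b), a hull subdomain D' (same marked points, agreeing with D near a
and b) and an endpoint approximation
(a_δ, b_δ). Along the critical δℤ² SAW γ = (γ_0 = a_δ, …, γ_N = b_δ) put q_n := 1[γ[0,n] ⊆ cl D'] ·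
H'(γ[0,n]) / H(γ[0,n]), where H(η) is
the 4^{-|ω|}-mass of nearest-neighbour walks of Ω_δ from the tip of η to b_δ that avoid η after time
0 and stop at b_δ (the lattice
excursion Poisson kernel of the slit graph) and H' the mass of those that moreover stay in cl D':
q_n is the LATTICE excursion-avoidance
ratio, the exponent-1 restriction value, and U_n := q_n^{5/8} is the explicit SLE_{8/3} value
function of LSW03 read through the random
walk (Lawler2006 §4.5: Q_SLE = Q^{5/8}). Exactly (DefectIdentity): P_δ(γ ⊆ cl D') = E_δ[U_N] = U_0 +
E_δ Σ_{n<N} (U_{n+1} − U_n), and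
with f(q) = q^{5/8} the increment splits identically as U_{n+1} − U_n = f'(q_n)[Δq_n − (3/16)
Δq_n²/q_n] + R_n, because
½ f'' + (3/16) f'/q ≡ 0 — the q-coordinate form of LSW03 §5 (for SLE_{8/3}, dq = h'' dW + h''²/(2h')
dt, i.e. drift(q) = (3/16) d⟨q⟩/q,
3/16 = 1/(2κ), and q^{5/8} is the martingale, Prop. 5.2). (V) ExcursionInitialValue: q_0 → Φ'_A(0)
(exponent-1 restriction for the
lattice excursion, A = φ.pullbackHull D'). (B) BalanceChannel: E_δ Σ_n (5/8) q_n^{-3/8} [Δq_n −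
(3/16) Δq_n²/q_n] → 0 — the κ = 8/3 /
α = 5/8 content as ONE averaged sum rule along the polymer (it is h''·(drift channel) + [h'''/2 −
(3/16)h''²/h']·(κ channel) of the card,
coordinate-free). (R) CubicRemainder: E_δ Σ_n R_n → 0 (tip regularity). Then P_δ(γ ⊆ cl D') →
Φ'_A(0)^{5/8} = AvoidanceLimit (shared,
stmt-CriticalPhenomena-4981), and (T) EventualTight ∧ (S) SimpleSubseqLimits close through the
restriction tail shared verbatim with
route SAWLoopFugacityFlow (AvoidancePassage, AvoidanceDeterminesLaw, SLECarrier, SLEAvoidanceValue;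
borrowed closing of card
excursion-cocycle-five-eighths, whose support s2 is our (V)).
Lean: `ExcursionInitialValue ∧ BalanceChannel ∧ CubicRemainder ∧ EventualTight ∧ SimpleSubseqLimits`

## Assembly
Fix (D; a, b) and an endpoint approximation; DefectToAvoidance turns DefectIdentity ∧
ExcursionInitialValue ∧ BalanceChannel ∧
CubicRemainder into AvoidanceLimit (continuity of x^(5/8) and ofReal, telescoping); from there the
tail is VERBATIM the Assembly of
SAWLoopFugacityFlow (stmt-CriticalPhenomena-4988): eventual probability measures
(IsEndpointApprox.reachable), EventualTight + Prokhorov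
on the Polish space CurveClass ℂ extract subsequential limits ν, SLECarrier / SLEAvoidanceValue /
AvoidancePassage / SimpleSubseqLimits /
AvoidanceDeterminesLaw identify ν with the chordal SLE_(8/3) law (exists_isSLECurve,
IsSLECurve.map_eq), and the subsequence principle
along 𝓝[>]0 gives ConvergesInLawToSLE (8/3) = SAWScalingLimit. The reduction "glue + sibling tail ⇒
Assembly" is a term-mode example in
the planner's Sketch.lean.

Rationale: WHY THIS LINE. Stein's method / generator comparison (Barbour doi:10.1007/bf01197887, Chatterjee2006
Lindeberg telescoping, Braverman arXiv:2102.12027)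
says: error of a functional = E Σ (prelimit generator − limit generator) applied to the limit's
value function; for a random CURVE the
limit generator is the SLE backward operator and the value function is unknown in closed form —
except at κ = 8/3 for the determining
class of hull-avoidance events, where conformal restriction (LawlerSchrammWerner2003Restriction Thm
6.1, Prop. 5.2, Prop. 4.1) hands it
over as (excursion avoidance)^{5/8}, and the excursion avoidance has an exact lattice twin (ratio of
random-walk path sums in the slit
graph, the object of KozdronLawler2005 / Lawler2006 / KennedyLawler2013). So the whole discrepancy
"SAW vs SLE_{8/3}" on the π-system that
determines laws of simple chords becomes an EXACT finite identity on δℤ² whose terms are one-step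
defects of an explicit function under
the exact (non-local, consistent) SAW growth kernel x_c Z(ηu)/Z(η); imported areas: Stein's method
(probability), conformal restriction
and excursion theory (complex analysis / SLE), discrete potential theory. What it does that prior
routes do not: SAWLoopFugacityFlow /
SAWChargeContinuation / SAWFrontierHomotopy take the 5/8 avoidance law (AvoidanceLimit) as ONE
scalar crux reached by deformation in an
external parameter; SAWLaplacianWalk asks a POINTWISE kernel law (K58) for every past; here
AvoidanceLimit is split, by an identity that
costs nothing, into an initial-value statement about random walks only (V), one AVERAGED kernel sum
rule with explicit weights in which
5/8 and 3/16 = 1/(2κ) are visible (B), and a tip-regularity statement (R) — each attackable and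
falsifiable separately, with tomography
(where along the walk the error sits) and rates (any bound on the defect sums is a quantitative
5/8-law, cf. arXiv:1205.5734,
arXiv:2407.10243) for free. Negatives index: only stmt-CriticalPhenomena-0772 (all-δ tightness),
avoided by EventualTight.

RANKED CRUXES. #2 BalanceChannel (crux) — (card KappaChannel+DriftChannel, intrinsic form) for every
Dobrushin D, hull subdomain D' (D' ⊆ D, same marked points, agreeing with D in balls around a and b)
and endpoint approximation, with q_n the lattice excursion-avoidance ratio of the past γ[0,n]
(1[past ⊆ cl D']·H'/H as in the Thesis), the expected signed balance defect E_δ Σ_{n<N} (5/8)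
q_n^{-3/8} [ (q_{n+1} − q_n) − (3/16)(q_{n+1} − q_n)²/q_n ] under SAW.law tends to 0 as δ → 0⁺. By
the tower property this is E Σ_n f'(q_n)[m1(γ[0,n]) − (3/16) m2(γ[0,n])/q_n] with m1, m2 the first
two conditional moments of Δq under the exact SAW kernel: "the polymer pushes the
excursion-avoidance ratio up by 3/16 of its conditional variance over its value, on average along
the walk". [difficulty: open-problem] (why it might fail: Given (V),(R) it is EQUIVALENT to the
5/8-law: false iff SAW ≠ SLE_{8/3} on ℤ² for some endpoint convention; the honest risk is no gain —
the signed sum may vanish only by cancellation along the walk (lattice tip biases of m1 at order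
m2), leaving no local handle.) [LawlerSchrammWerner2003Restriction, Lawler2006, KennedyLawler2013,
DyhrGilbertKennedyLawlerPasson2011, Chatterjee2006, arXiv:1205.5734, Kennedy2002]
#3 CubicRemainder (crux) — (card Remainder) in the same setting, the expected Taylor remainder E_δ
Σ_{n<N} [ q_{n+1}^{5/8} − q_n^{5/8} − (5/8) q_n^{-3/8} Δq_n + (15/128) q_n^{-11/8} Δq_n² ] tends to
0 as δ → 0⁺: third-order smallness of the one-step jumps of the excursion-avoidance ratio along SAW
pasts, including the absorption jump (stepping out of cl D' costs −(33/128) q^{5/8} in this sum, so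
the tip must reach ∂D' only from pasts with small q). [difficulty: L] (why it might fail: Needs
|Δq/q| ≲ 1/k at lattice distance kδ from D∖D' (discrete Harnack at a slit tip with fjords, unproved
for SAW pasts) and no pile-up of steps near ∂D' before absorption; a polymer creeping along ∂D' for
≫ δ^{-1/2} steps, or absorption at q ≍ 1, breaks it (dominant at toy sizes).) [KennedyLawler2013,
Chelkak2016, KozdronLawler2005, LawlerSchrammWerner2004SAW, Lawler2005]
#4 ExcursionInitialValue (crux) — (card: initial value of the value function; = support s2 of card
excursion-cocycle-five-eighths) for D, D', endpoint approximation as above and every chordal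
uniformizing φ : ℍ → D with restriction data (Φ, d = Φ'_A(0)) of A = φ.pullbackHull D', the initial
lattice excursion-avoidance ratio q_0 = H'([a_δ]; a_δ)/H([a_δ]; a_δ) — the probability that simple
random walk from a_δ, conditioned to reach b_δ before leaving Ω_δ or returning to a_δ, stays in cl
D' — tends to d as δ → 0⁺ (restriction exponent 1 for the Brownian excursion, LSW03 Prop. 4.1, on
the lattice). [difficulty: L] (why it might fail: Endpoints at mesoscopic depth (IsEndpointApprox
only gives δ·a_δ → a) in a ROUGH Jordan domain need a δ-uniform boundary Harnack principle at both
ends for ratios of discrete harmonic functions (KozdronLawler2005 covers grid domains, separated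
boundary points only); false without 'agree near a, b'.) [LawlerSchrammWerner2003Restriction,
KozdronLawler2005, Chelkak2016, Kozdron2007Fomin, Lawler2006]
#5 SimpleSubseqLimits (crux) — (shared verbatim with SAWLoopFugacityFlow.SimpleSubseqLimits,
stmt-CriticalPhenomena-4982) for every Dobrushin domain, endpoint approximation, sequence s_n → 0⁺
and probability measure ν on CurveClass ℂ that is the weak limit of the pushed-forward SAW laws
along s_n, ν-a.e. curve class is simple, runs from a to b, has range in cl D and meets ∂D only at a,
b (the carrier clause of AvoidanceDeterminesLaw). [difficulty: open-problem] (why it might fail: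
Weak limits of simple polylines need not be simple, non-retracing or boundary-avoiding: needs
no-macroscopic-self-approach and no-boundary-crawling bounds at x_c under every IsEndpointApprox;
only sub-ballisticity is in print.) [LawlerSchrammWerner2004SAW, KennedyLawler2013,
DuminilCopinHammond2013, arXiv:2310.17299, AizenmanBurchardDuke1999]
#9 DefectIdentity (support) — the exact Stein/Dynkin identity in terminal-value form: eventually in
δ, P_δ(range γ ⊆ cl D') = E_δ[q_N^{5/8}] (the terminal value q_N^{5/8} is the avoidance indicator: H
= H' = 1 at the tip b_δ once δ·b_δ ∈ D', and the past indicator is the event), so that by finite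
telescoping P_δ(avoid) = q_0^{5/8} + E_δ Σ_{n<N}(q_{n+1}^{5/8} − q_n^{5/8}) = q_0^{5/8} + (balance
sum) + (remainder sum) identically. Finite sums on a finite probability space; first-step
bookkeeping only. Checked numerically to 1e-6 by exact enumeration (5×3 … 7×5 boxes, this seat).
[difficulty: provable-now] [LawlerSchrammWerner2004SAW, Lawler2005ConformallyInvariant,
Chatterjee2006]
#9 DefectToAvoidance (support) — the layer-1 glue: DefectIdentity → ExcursionInitialValue →
BalanceChannel → CubicRemainder → AvoidanceLimit. Proof: P_δ(avoid) = ofReal(q_0^{5/8} + balance +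
remainder) by the identity and telescoping (linearity of the integral on a finite probability space,
q_0 deterministic); the two sums → 0, q_0 → d and x ↦ x^{5/8}, ofReal are continuous. Bookkeeping
only. [difficulty: S] [LawlerSchrammWerner2003Restriction, Chatterjee2006]
#9 AvoidanceLimit (support) — (shared verbatim: the rank-2 crux of SAWLoopFugacityFlow /
SAWChargeContinuation, stmt-CriticalPhenomena-4981; DERIVED here) the 5/8 avoidance law: for D, hull
subdomain D', every endpoint approximation, chordal uniformizing φ and restriction data (Φ, d) of A
= φ.pullbackHull D', P_δ(range γ_δ ⊆ cl D') → d^(5/8) as δ → 0⁺. [difficulty: open-problem]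
[LawlerSchrammWerner2004SAW, LawlerSchrammWerner2003Restriction, KennedyLawler2013,
DyhrGilbertKennedyLawlerPasson2011]
#9 EventualTight (support) — (shared verbatim, stmt-CriticalPhenomena-1372) for every Dobrushin
domain and endpoint approximation there is δ₀ > 0 with {(law D δ a_δ b_δ).map curve : δ ∈ (0, δ₀]}
tight — the repaired (∃ δ₀) form of the refuted all-δ stmt-CriticalPhenomena-0772; load-bearing for
the Assembly, support because shared and value-free. [difficulty: open-problem]
[KemppainenSmirnov2017, AizenmanBurchardDuke1999, DuminilCopinHammond2013]
#9 AvoidancePassage (support) — (shared verbatim, stmt-CriticalPhenomena-4984) portmanteau sandwich: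
if ν is the weak limit of the pushed-forward SAW laws along s_n → 0⁺, μ is the chordal SLE_(8/3) law
of D, and along s_n the SAW avoidance probabilities of EVERY hull subdomain D'' converge to μ(range
⊆ cl D''), then ν(range ⊆ cl D') = μ(range ⊆ cl D') for every hull subdomain D'. [difficulty: M]
[LawlerSchrammWerner2003Restriction, AizenmanBurchardDuke1999]
#9 AvoidanceDeterminesLaw (support) — (shared verbatim, stmt-CriticalPhenomena-1373) two probability
measures on CurveClass ℂ carried by simple chords of D from a to b meeting ∂D only at a, b that give
the same mass to {range ⊆ cl D'} for every hull subdomain D' are equal (curve-space LSW03 Lemma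
3.2). [difficulty: M] [LawlerSchrammWerner2003Restriction, AizenmanBurchardDuke1999]
#9 SLECarrier (support) — (shared verbatim, stmt-CriticalPhenomena-4985) the chordal SLE_(8/3) law
of a Dobrushin domain is a probability measure carried by simple curve classes from a to b with
range in cl D meeting ∂D only at a, b; expected to close from the tree. [difficulty: provable-now]
[RohdeSchramm2005, LawlerSchrammWerner2003Restriction, Lawler2005]
#9 SLEAvoidanceValue (support) — (shared verbatim, stmt-CriticalPhenomena-4986) LSW03 Thm 6.1
transposed to hull subdomains: for μ the chordal SLE_(8/3) law of D and D', φ, Φ, d as above,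
μ(range ⊆ cl D') = ofReal(d^(5/8)); expected to close from the tree
(sle_restriction_eightThirds_holds + HullRestrictionNull). [difficulty: provable-now]
[LawlerSchrammWerner2003Restriction]

TWO-LAYER PLAN. BalanceChannel ⇐ DriftChannel → KappaChannel → BalanceChannel (k = 2), once the
definition LatticeSlitIncrements lands (half-plane driving
increment Δξ_u and capacity increment Δt_u of appending the lattice edge (tip, u) to a
boundary-attached lattice slit, through a chordal
uniformizer φ and the tree's Loewner/hcap API; stem = hyperbolic geodesic of D from a to δ·a_δ):
DriftChannel = E Σ_n h_n''·m1^ξ(γ[0,n]) → 0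
(left–right balance of the kernel in conformal coordinates; killed identically by reflection pairs
in symmetric domains), KappaChannel =
E Σ_n [h_n'''/2 − (3/16) h_n''²/h_n']·(m2^ξ − (8/3)τ)(γ[0,n]) → 0 (conformal step variance per unit
capacity = 8/3 on average along the
walk, weighted), glue = the second-order expansion Δq = h''Δξ + [h''²/(2h') − (4/3)h''']Δt +
½h'''Δξ² + O(3) of LSW03 §5 transported to
lattice steps. CubicRemainder ⇐ (absorption: E[q_{τ-1}^{5/8}; γ leaves cl D'] → 0) → (bulk: Σ_n
E[q_n^{5/8}|Δq_n/q_n|³; no absorption] → 0)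
→ CubicRemainder. ExcursionInitialValue ⇐ (uniform boundary Harnack for ratios of discrete harmonic
functions near a and b, Chelkak2016)
→ (interior invariance principle for the h-transformed walk) → ExcursionInitialValue.
SimpleSubseqLimits as in the sibling route.

KILL CRITERIA. ¬AvoidanceLimit for some hull subdomain / endpoint approximation (a DIFFERENT limit
of the same-endpoint partition-function ratio) refutes
LSW04's restriction prediction as typed and closes this route together with SAWLoopFugacityFlow,
SAWChargeContinuation, SAWFrontierHomotopy
(close --reason refuted:AvoidanceLimit); by the exact identity, given ExcursionInitialValue and
CubicRemainder this is the same event as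
¬BalanceChannel, so ¬BalanceChannel alone (with the other two proved or numerically solid) is
equally fatal. ¬ExcursionInitialValue can only
come from pathological endpoint approximations (mesoscopic depth + rough boundary): pivot = restate
all three lattice cruxes for
boundary-vertex endpoint approximations (shared pivot with EndpointRobust of SAWConfRestriction /
SAWCircleScreening's one-convention
thesis). ¬CubicRemainder with BalanceChannel + Remainder-sum still → the right total means the
q-Taylor split is the wrong bookkeeping
(absorption jumps not small): pivot to the stopped value function (stop at q < θ, let θ → 0) — a
restate, not a close. AvoidanceLimit proved
elsewhere (any PFR route) moots layer 1 here but not the tomography/rate use; ¬SimpleSubseqLimits or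
¬EventualTight refute the conjunct as
typed for every route.

NOT DECOMPOSED YET. The conformal-coordinate channels (DriftChannel, KappaChannel) and their glue —
they need LatticeSlitIncrements and are layer-2 children of
BalanceChannel; windowed / conditional versions of the balance law (mesoscopic windows, uniform in
the past: the form that would also
identify the driving process, KS-style) — stronger than needed for the 5/8-law; quantitative
versions (Σ E|defect| = O(δ^θ) ⇒ rate of
convergence in the hull topology, arXiv:1205.5734 / arXiv:2407.10243 framework) — a later target
once any bound exists; the tip-regularity
lemmas inside CubicRemainder (discrete Harnack at a slit tip with fjords; time spent near ∂D' before
absorption); lattice bookkeeping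
(largest-component convention of Ω_δ vs cl D', polyline-vs-vertex avoidance, finiteness/summability
of H, H', integrability on the finite
SAW space) left to grounders/provers of DefectIdentity. No Target decl: X is literally the
conjunction of the five named decls.

CHEAPEST FALSIFIER. Exact enumeration, RUN in this seat (pure python, 21 s; folder tomography.out;
kit socket absent, toy sizes only): boxes 5×3, 5×4, 6×4,
7×5 sites, a, b = mid-points of the short sides, D' = box minus a one-row top-middle bump, x = x_c:
(i) the identity P(avoid) =
E[q_N^{5/8}] = q_0^{5/8} + balance + remainder holds to 1e-6 (P = 0.5314, 0.5793, 0.6167, 0.7665);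
(ii) the two halves of the balance law,
F1 = E Σ f'Δq and S2 = E Σ (15/128)q^{-11/8}Δq², have ratio F1/S2 = 0.548, 0.735, 0.770, 1.080
(prediction → 1): the signed balance sum
(−0.024, −0.013, −0.013, +0.003) is 20–180× below E Σ|f'Δq| ≈ 0.5; (iii) the remainder carries the
total error at these sizes (R = −0.090,
−0.083, −0.068, −0.045; total P(avoid) − q_0^{5/8} = −0.113, −0.096, −0.081, −0.042). Refuter's
first move: the same functionals at
W = 10–14 with SAW sampling instead of enumeration (unbiased; H, H' are sparse solves): the line
dies if F1/S2 drifts away from 1 or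
|balance| stops decreasing while the total error does; it is wounded (pivot to a stopped value
function) if R does not decay. Lookup done:
Kennedy2002/Kennedy2004 confirm the SLE_(8/3) hitting law 1 − Φ'^(5/8) for the half-plane ℤ² SAW to
< 1%.

NUMBERS. κ = 8/3; restriction exponent α = (6 − κ)/(2κ) = 1 − 1/κ = 5/8 = 0.625 (LSW03 Prop. 5.2,
Thm 6.1); excursion exponent 1 (LSW03 Prop. 4.1);
balance constant c = (1 − α)/2 = 1/(2κ) = 3/16 = 0.1875 (drift(q) = c·d⟨q⟩/q for q_t = h_t'(W_t)
under SLE_(8/3): dq = h''dW + h''²/(2h')dt,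
d⟨q⟩ = (8/3)h''²dt); weights f' = (5/8)q^(−3/8), ½f'' = −(15/128)q^(−11/8), absorption jump in the
remainder = −(33/128)q^(5/8);
continuum expansion Δq = h''Δξ + [h''²/(2h') − (4/3)h''']Δt + ½h'''Δξ² (LSW03 §5 display before
Prop. 5.2). SAW: x_c = 1/μ, μ ∈ [2.6, 2.7]
(LawlerSchrammWerner2004SAW_connectiveConstant_bounds), μ ≈ 2.63815853; N ≍ δ^(−4/3) steps (ν =
3/4); one exposed lattice step has
Δt ≍ δ·|scale|, |Δξ| ≍ (δ·scale)^(1/2), so Σ_n |Δξ_n|³ ≲ (max_n Δt_n)^(1/2)·hcap = O(δ^(1/2)) in the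
bulk. Toy tomography (this seat, exact):
see Cheapest falsifier — F1/S2 = 0.548 → 1.080 from 15 to 35 sites; total 5/8-law error −0.113 →
−0.042. Items at open: 13 (1 assembly,
4 cruxes, 8 supports; 6 supports and the crux SimpleSubseqLimits are shared verbatim with
SAWLoopFugacityFlow).

DEFINITION REQUESTS. LatticeSlitIncrements (topic Summits/CriticalPhenomena/SAWScalingLimit/Theorems
or Literature/Probability/RandomPlanarGeometry next to
SlitIncrement / LoewnerHullCapacity): for a Dobrushin domain D, a chordal uniformizing φ : ℍ → D and
a lattice past η (a walk of
discreteDomainGraph D.carrier δ from a_δ), K_η := the ℍ-hull filled by φ⁻¹(polyline η ∩ D) ∪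
(hyperbolic geodesic of ℍ from 0 to
φ⁻¹(δ·a_δ)); t_η := hcap K_η; ξ_η := g_{K_η}(tip image) when the tip is on ∂(ℍ ∖ K_η) (junk 0
otherwise); Δξ_u := ξ_{ηu} − ξ_η, Δt_u :=
t_{ηu} − t_η, and h_η := the restriction map of g_{K_η}(φ⁻¹ A) re-centred at ξ_η with its first
three derivatives there. Filed after open
with `ledger workitem add --kind definition --notion LatticeSlitIncrements --for <BalanceChannel>`;
needed only for the foreseen
Drift/Kappa split and for conformal-coordinate tomography, not for any item filed now. Cite facts
that would help provers of
ExcursionInitialValue (kind cite, later, not filed now): KozdronLawler2005 Poisson-kernel ratio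
convergence in grid domains; Chelkak2016
uniform boundary Harnack (Thm 3.x) for discrete harmonic functions in rough domains.

Novelty: Searches (2026-08-15): `lit frontier CriticalPhenomena --since 2020` (30 rows; closest continuum
tool arXiv:2601.10539, smoothness of
SLE martingale observables / generalised Feynman–Kac); `lit bridges CriticalPhenomena --cross any`
(30 rows, none relevant);
`lit galaxy search --star all` ×4 ("Stein's method Schramm-Loewner" 0, "rate of convergence to SLE"
0, "convergence rates for loop-erased
random walk" 0, "Laplacian-b" 30 noise); `lit search --source zbmath` ×6: "Schramm-Loewner evolution
rate of convergence" (10: arXiv:1205.5734,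
arXiv:0911.3988, arXiv:2407.10243, arXiv:2301.04722 …), "Stein's method diffusion approximation
generator approach" (7: arXiv:2102.12027
Braverman prelimit generator comparison, …), "Barbour Stein's method for diffusion approximations"
(4: doi:10.1007/bf01197887, arXiv:1702.03130),
"self-avoiding walk SLE 8/3 restriction property lattice" (2: Lawler–Lind 2007, arXiv:0909.0203),
"Laplacian random walk excursion Poisson
kernel SLE" (1: Lawler2006), one query 0; `lit vsearch` of the mechanism in prose (10
numerical-analysis books, nothing); `lit read
arXiv:math/0209343` pp. 10, 12–14 (verified Prop. 4.1, the d[h_t'(W_t)] display, Prop. 5.2, Thm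
6.1); local searchd / arXiv / OpenAlex / S2
rate-limited or rc 75 this session (logged); the 140-card pool via `ledger idea list` (nearest:
turn-defect-kernel-orthogonality = IG
harmonic-extension defect identity on the hexagonal lattice, other observable, other closing;
excursion-cocycle-five-eighths = the  [refs: 10.1007/bf01197887, 2601.10539, 1205.5734, 0911.3988, 2407.10243, 2301.04722, 2102.12027, 1702.03130, 0909.0203, math/0209343, doi:10.1007/bf01197887, Lawler2006, DyhrGilbertKennedyLawlerPasson2011, KennedyLawler2013]

Barriers (technique_class: generator-comparison, restriction-value-function): - technique_class: generator-comparison, restriction-value-function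
- Literature.Barriers.CriticalPhenomena.SAWNotKineticallyGrown: evaded — the only growth kernel used
is the exact disintegration x_c Z(ηu)/Z(η) of SAW.law along the walk (consistent by construction,
non-local through the whole slit graph); it enters only through the tower property (conditional
moments m1, m2), never as a posited local rule, so the κ = 6 locality trap of kinetic walks does not
arise.
- Literature.Barriers.CriticalPhenomena.NienhuisWeightsExcludeVertexSAW: not engaged — no discretely
holomorphic SAW observable and no exact local linear relation (HasExactVertexRelationZ2) is
asserted; the identity is global bookkeeping (telescoping) and the only exactly harmonic object is
the random-walk mass H.
- Literature.Barriers.CriticalPhenomena.ParafermionicHalfCauchyRiemann: not engaged for the same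
reason (no parafermion; the value function is a ratio of Dirichlet solutions, fully determined by
its boundary data).
- Literature.Barriers.CriticalPhenomena.EmbeddingModulusUniqueness: engaged honestly — the conformal
input is the isotropic simple random walk of ℤ² inside q (ExcursionInitialValue is false on a
sheared lattice with the same SAW weights), so the argument is embedding-aware, as Beffara's modulus
uniqueness requires.
- Literature.Barriers.CriticalPhenomena.GridSAWCountingSharpPComplete: touches only the numerics —
the cruxes are asymptotics of expectations; tomography beyond toy sizes samples wa

History (route lifecycle, newest last):
- 2026-08-15T16:22:02Z · rev 1: restated Assembly (stmt-CriticalPhenomena-7522) — route-repair (glue): restate Assembly fact-free — drop the 4 Literature antecedents (polishSpace, IsSLECurve.map_eq, exists_isChordalUniformizing are tree theor (planner-rbadge-CriticalPhenomena-SAWSteinDefec-d929005a-g2-0)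
- 2026-08-26T03:37:38Z · DORMANT — reconciler: no traction for 8.3 d (last activity statement-attached at 2026-08-17T19:22:02Z); parked, not closed — `ledger route dormant route-CriticalPhenomena (operator:999:2335494)

sub-problem: SAWScalingLimit · status: dormant · opened planner-plancard-CriticalPhenomena-SAWScaling-d6a06d8c-0 2026-08-15T12:11:03Z · rev 1 · ledger route-CriticalPhenomena-SAWSteinDefect
GENERATED by the gate from the ledger (D-0016/17). Provers cite these decls: `theorem foo : Summit.CriticalPhenomena.SAWScalingLimit.Theses.SAWSteinDefect.<Decl> := …` in Summits/CriticalPhenomena/SAWScalingLimit/Theorems/<Name>.lean.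
-/

namespace Summit.CriticalPhenomena.SAWScalingLimit.Theses.SAWSteinDefect

open scoped BigOperators Topology Manifold Classical MeasureTheory ProbabilityTheory Matrix InnerProductSpace ComplexConjugate ContinuousMap
open Filter Set Function TopologicalSpace MeasureTheory

attribute [summit_statement] _root_.SAWScalingLimit

/-- item stmt-CriticalPhenomena-7509 · crux · rank 2 · open · by planner
why it might fail: Given (V),(R) it is EQUIVALENT to the 5/8-law: false iff SAW ≠ SLE_{8/3} on ℤ² for some endpoint convention; the honest risk is no gain — the signed sum may vanish only by cancellation along the walk (lattice tip biases of m1 at order m2), leaving no local handle.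
sources: LawlerSchrammWerner2003Restriction, Lawler2006, KennedyLawler2013, DyhrGilbertKennedyLawlerPasson2011, Chatterjee2006, arXiv:1205.5734
[crux] (card KappaChannel+DriftChannel, intrinsic form) for every Dobrushin D, hull subdomain D' (D'
⊆ D, same marked points, agreeing with D in balls around a and b) and endpoint approximation, with
q_n the lattice excursion-avoidance ratio of the past γ[0,n] (1[past ⊆ cl D']·H'/H as in the
Thesis), the expected signed balance defect E_δ Σ_{n<N} (5/8) q_n^{-3/8} [ (q_{n+1} − q_n) −
(3/16)(q_{n+1} − q_n)²/q_n ] under SAW.law tends to 0 as δ → 0⁺. By the tower property this is E Σ_n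
f'(q_n)[m1(γ[0,n]) − (3/16) m2(γ[0,n])/q_n] with m1, m2 the first two conditional moments of Δq
under the exact SAW kernel: "the polymer pushes the excursion-avoidance ratio up by 3/16 of its
conditional variance over its value, on average along the walk". [difficulty: open-problem] -/
@[route_item "route-CriticalPhenomena-SAWSteinDefect", crux]
def BalanceChannel : Prop :=
  ∀ (D D' : Literature.Probability.RandomPlanarGeometry.DobrushinDomain) (a b : ℝ → Literature.Probability.LatticeModels.Site 2), let H : ℝ → List (Literature.Probability.LatticeModels.Site 2) → Literature.Probability.LatticeModels.Site 2 → ℝ := fun δ S w => ∑' ω : (Literature.Probability.LatticeModels.discreteDomainGraph D.carrier δ).Walk w (b δ), if (∀ v ∈ ω.support.tail, v ∉ S) ∧ b δ ∉ ω.support.dropLast then (1 / 4 : ℝ) ^ ω.length else 0; let H' : ℝ → List (Literature.Probability.LatticeModels.Site 2) → Literature.Probability.LatticeModels.Site 2 → ℝ := fun δ S w => ∑' ω : (Literature.Probability.LatticeModels.discreteDomainGraph D.carrier δ).Walk w (b δ), if (∀ v ∈ ω.support.tail, v ∉ S) ∧ b δ ∉ ω.support.dropLast ∧ Set.range (ω.toCurve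 (Literature.Probability.LatticeModels.meshPoint δ)) ⊆ closure D'.carrier then (1 / 4 : ℝ) ^ ω.length else 0; let Q : (δ : ℝ) → Literature.Probability.RandomPlanarGeometry.SAW.DomainSAW D.carrier δ (a δ) (b δ) → ℕ → ℝ := fun δ γ n => if Set.range ((γ.walk.take n).toCurve (Literature.Probability.LatticeModels.meshPoint δ)) ⊆ closure D'.carrier then H' δ (γ.walk.take n).support (γ.walk.getVert n) / H δ (γ.walk.take n).support (γ.walk.getVert n) else 0; Literature.Probability.RandomPlanarGeometry.SAW.IsEndpointApprox D a b → D'.carrier ⊆ D.carrier → D'.pt 0 = D.pt 0 → D'.pt 1 = D.pt 1 → (∃ ε : ℝ, 0 < ε ∧ D'.carrier ∩ Metric.ball (D.pt 0) ε = D.carrier ∩ Metric.ball (D.pt 0) ε ∧ D'.carrier ∩ Metric.ball (D.pt 1) ε = D.carrier ∩ Metric.ball (D.pt 1) ε) → Filter.Tendsto (fun δ => ∫ γ, (∑ n ∈ Finset.range γ.length, (5 / 8 : ℝ) * Q δ γ n ^ (-(3 : ℝ) / 8) * ((Q δ γ (n + 1) - Q δ γ n) - (3 / 16 : ℝ) *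 (Q δ γ (n + 1) - Q δ γ n) ^ 2 / Q δ γ n)) ∂(Literature.Probability.RandomPlanarGeometry.SAW.law D.carrier δ (a δ) (b δ))) (nhdsWithin 0 (Set.Ioi 0)) (nhds 0)

/-- item stmt-CriticalPhenomena-7518 · crux · rank 3 · open · by planner
why it might fail: Needs |Δq/q| ≲ 1/k at lattice distance kδ from D∖D' (discrete Harnack at a slit tip with fjords, unproved for SAW pasts) and no pile-up of steps near ∂D' before absorption; a polymer creeping along ∂D' for ≫ δ^{-1/2} steps, or absorption at q ≍ 1, breaks it (dominant at toy sizes).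
sources: KennedyLawler2013, Chelkak2016, KozdronLawler2005, LawlerSchrammWerner2004SAW, Lawler2005
[crux] (card Remainder) in the same setting, the expected Taylor remainder E_δ Σ_{n<N} [
q_{n+1}^{5/8} − q_n^{5/8} − (5/8) q_n^{-3/8} Δq_n + (15/128) q_n^{-11/8} Δq_n² ] tends to 0 as δ →
0⁺: third-order smallness of the one-step jumps of the excursion-avoidance ratio along SAW pasts,
including the absorption jump (stepping out of cl D' costs −(33/128) q^{5/8} in this sum, so the tip
must reach ∂D' only from pasts with small q). [difficulty: L] -/
@[route_item "route-CriticalPhenomena-SAWSteinDefect", crux]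
def CubicRemainder : Prop :=
  ∀ (D D' : Literature.Probability.RandomPlanarGeometry.DobrushinDomain) (a b : ℝ → Literature.Probability.LatticeModels.Site 2), let H : ℝ → List (Literature.Probability.LatticeModels.Site 2) → Literature.Probability.LatticeModels.Site 2 → ℝ := fun δ S w => ∑' ω : (Literature.Probability.LatticeModels.discreteDomainGraph D.carrier δ).Walk w (b δ), if (∀ v ∈ ω.support.tail, v ∉ S) ∧ b δ ∉ ω.support.dropLast then (1 / 4 : ℝ) ^ ω.length else 0; let H' : ℝ → List (Literature.Probability.LatticeModels.Site 2) → Literature.Probability.LatticeModels.Site 2 → ℝ := fun δ S w => ∑' ω : (Literature.Probability.LatticeModels.discreteDomainGraph D.carrier δ).Walk w (b δ), if (∀ v ∈ ω.support.tail, v ∉ S) ∧ b δ ∉ ω.support.dropLast ∧ Set.range (ω.toCurve (Literature.Probability.LatticeModels.meshPoint δ)) ⊆ closure D'.carrier then (1 / 4 : ℝ) ^ ω.length else 0; let Q : (δ : ℝ) → Literature.Probability.RandomPlanarGeometry.SAW.DomainSAW D.carrier δ (a δ) (b δ) → ℕ → ℝ := fun δ γ n => if Set.range ((γ.walk.take n).toCurve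 (Literature.Probability.LatticeModels.meshPoint δ)) ⊆ closure D'.carrier then H' δ (γ.walk.take n).support (γ.walk.getVert n) / H δ (γ.walk.take n).support (γ.walk.getVert n) else 0; Literature.Probability.RandomPlanarGeometry.SAW.IsEndpointApprox D a b → D'.carrier ⊆ D.carrier → D'.pt 0 = D.pt 0 → D'.pt 1 = D.pt 1 → (∃ ε : ℝ, 0 < ε ∧ D'.carrier ∩ Metric.ball (D.pt 0) ε = D.carrier ∩ Metric.ball (D.pt 0) ε ∧ D'.carrier ∩ Metric.ball (D.pt 1) ε = D.carrier ∩ Metric.ball (D.pt 1) ε) → Filter.Tendsto (fun δ => ∫ γ, (∑ n ∈ Finset.range γ.length, (Q δ γ (n + 1) ^ ((5 : ℝ) / 8) - Q δ γ n ^ ((5 : ℝ) / 8) - (5 / 8 : ℝ) * Q δ γ n ^ (-(3 : ℝ) / 8) * (Q δ γ (n + 1) - Q δ γ n) + (15 / 128 : ℝ) * Q δ γ n ^ (-(11 : ℝ) / 8) * (Q δ γ (n + 1) - Q δ γ n) ^ 2)) ∂(Literature.Probability.RandomPlanarGeometry.SAW.law D.carrier δ (a δ) (b δ))) (nhdsWithin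 0 (Set.Ioi 0)) (nhds 0)

/-- item stmt-CriticalPhenomena-7519 · crux · rank 4 · open · by planner
why it might fail: Endpoints at mesoscopic depth (IsEndpointApprox only gives δ·a_δ → a) in a ROUGH Jordan domain need a δ-uniform boundary Harnack principle at both ends for ratios of discrete harmonic functions (KozdronLawler2005 covers grid domains, separated boundary points only); false without 'agree near a, b'.
sources: LawlerSchrammWerner2003Restriction, KozdronLawler2005, Chelkak2016, Kozdron2007Fomin, Lawler2006
[crux] (card: initial value of the value function; = support s2 of card
excursion-cocycle-five-eighths) for D, D', endpoint approximation as above and every chordal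
uniformizing φ : ℍ → D with restriction data (Φ, d = Φ'_A(0)) of A = φ.pullbackHull D', the initial
lattice excursion-avoidance ratio q_0 = H'([a_δ]; a_δ)/H([a_δ]; a_δ) — the probability that simple
random walk from a_δ, conditioned to reach b_δ before leaving Ω_δ or returning to a_δ, stays in cl
D' — tends to d as δ → 0⁺ (restriction exponent 1 for the Brownian excursion, LSW03 Prop. 4.1, on
the lattice). [difficulty: L] -/
@[route_item "route-CriticalPhenomena-SAWSteinDefect", crux]
def ExcursionInitialValue : Prop :=
  ∀ (D D' : Literature.Probability.RandomPlanarGeometry.DobrushinDomain) (a b : ℝ → Literature.Probability.LatticeModels.Site 2), let H : ℝ → List (Literature.Probability.LatticeModels.Site 2) → Literature.Probability.LatticeModels.Site 2 → ℝ := fun δ S w => ∑' ω : (Literature.Probability.LatticeModels.discreteDomainGraph D.carrier δ).Walk w (b δ), if (∀ v ∈ ω.support.tail, v ∉ S) ∧ b δ ∉ ω.support.dropLast then (1 / 4 : ℝ) ^ ω.length else 0; let H' : ℝ → List (Literature.Probability.LatticeModels.Site 2) → Literature.Probability.LatticeModels.Site 2 → ℝ := fun δ S w => ∑' ω : (Literature.Probability.LatticeModels.discreteDomainGraph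 D.carrier δ).Walk w (b δ), if (∀ v ∈ ω.support.tail, v ∉ S) ∧ b δ ∉ ω.support.dropLast ∧ Set.range (ω.toCurve (Literature.Probability.LatticeModels.meshPoint δ)) ⊆ closure D'.carrier then (1 / 4 : ℝ) ^ ω.length else 0; Literature.Probability.RandomPlanarGeometry.SAW.IsEndpointApprox D a b → D'.carrier ⊆ D.carrier → D'.pt 0 = D.pt 0 → D'.pt 1 = D.pt 1 → (∃ ε : ℝ, 0 < ε ∧ D'.carrier ∩ Metric.ball (D.pt 0) ε = D.carrier ∩ Metric.ball (D.pt 0) ε ∧ D'.carrier ∩ Metric.ball (D.pt 1) ε = D.carrier ∩ Metric.ball (D.pt 1) ε) → ∀ (φ : Literature.Probability.RandomPlanarGeometry.ConformalEquiv UpperHalfPlane.upperHalfPlaneSet D.carrier), D.IsChordalUniformizing φ → ∀ (Φ : Literature.Probability.RandomPlanarGeometry.ConformalEquiv (UpperHalfPlane.upperHalfPlaneSet \ φ.pullbackHull D') UpperHalfPlane.upperHalfPlaneSet) (d : ℝ), Literature.Probability.RandomPlanarGeometry.IsRestrictionMap (φ.pullbackHull D') Φ → Literature.Probability.RandomPlanarGeometry.HasRestrictionDeriv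 (φ.pullbackHull D') Φ d → Filter.Tendsto (fun δ => H' δ [a δ] (a δ) / H δ [a δ] (a δ)) (nhdsWithin 0 (Set.Ioi 0)) (nhds d)

/-- item stmt-CriticalPhenomena-4982 · crux · rank 5 · open · by planner
why it might fail: Weak limits of simple polylines need not be simple, non-retracing or boundary-avoiding: needs no-macroscopic-self-approach and no-boundary-crawling bounds at x_c under every IsEndpointApprox; only sub-ballisticity is in print.
sources: LawlerSchrammWerner2004SAW, KennedyLawler2013, DuminilCopinHammond2013, arXiv:2310.17299, AizenmanBurchardDuke1999
[crux] (S): for every Dobrushin domain, endpoint approximation, sequence s_n → 0+ and probability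
measure ν on CurveClass ℂ that is the weak limit of the pushed-forward SAW laws along s_n, ν-a.e.
curve class is simple, runs from a = D.pt 0 to b = D.pt 1, has range in closure D and meets ∂D only
at a, b (exactly the carrier clause of AvoidanceDeterminesLaw). Subsequential form of
SAWConfRestriction.SimpleOfLimit (stmt-CriticalPhenomena-0774). Foreseen split: 'range is a simple
boundary-avoiding arc' (follows from AvoidanceLimit + LSW Lemma 3.2 on filled ranges + SLE_(8/3)
simplicity) ∧ 'no retracing' (a near-self-approach estimate for x_c-SAW). [difficulty: open-problem] -/
@[route_item "route-CriticalPhenomena-SAWSteinDefect", crux]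
def SimpleSubseqLimits : Prop :=
  ∀ (D : Literature.Probability.RandomPlanarGeometry.DobrushinDomain) (a b : ℝ → Literature.Probability.LatticeModels.Site 2), Literature.Probability.RandomPlanarGeometry.SAW.IsEndpointApprox D a b → ∀ (s : ℕ → ℝ) (ν : MeasureTheory.Measure (Literature.Probability.RandomPlanarGeometry.CurveClass ℂ)), Filter.Tendsto s Filter.atTop (nhdsWithin 0 (Set.Ioi 0)) → MeasureTheory.IsProbabilityMeasure ν → (∀ f : BoundedContinuousFunction (Literature.Probability.RandomPlanarGeometry.CurveClass ℂ) ℝ, Filter.Tendsto (fun n => ∫ γ, f γ.curve ∂(Literature.Probability.RandomPlanarGeometry.SAW.law D.carrier (s n) (a (s n)) (b (s n)))) Filter.atTop (nhds (∫ x, f x ∂ν))) → ∀ᵐ γ ∂ν, γ ∈ Literature.Probability.RandomPlanarGeometry.CurveClass.simple ∧ γ.source = D.pt 0 ∧ γ.target = D.pt 1 ∧ γ.range ⊆ closure D.carrier ∧ γ.range ∩ frontier D.carrier ⊆ {D.pt 0, D.pt 1}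

/-- item stmt-CriticalPhenomena-1372 · support · rank 9 · open · by planner
sources: KemppainenSmirnov2017, AizenmanBurchardDuke1999, DuminilCopinHammond2013
[support] eventual tightness of the pushed-forward critical SAW laws: for every Dobrushin domain and
endpoint approximation there is δ₀ > 0 such that {(law D δ a_δ b_δ).map curve : δ ∈ (0, δ₀]} is a
tight set of measures on CurveClass ℂ — the repaired (∃ δ₀) form of the refuted all-δ statement
stmt-CriticalPhenomena-0772 suggested by its refutation; child-designate of LimitExists, shared need
of every SAW route. Intended tools: Aizenman–Burchard / Kemppainen–Smirnov Condition G2 (an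
annulus-crossing bound at x_c not in print). Sources: KemppainenSmirnov2017 Thm 1.5,
AizenmanBurchardDuke1999, DuminilCopinHammond2013. -/
@[route_item "route-CriticalPhenomena-SAWSteinDefect", crux]
def EventualTight : Prop :=
  ∀ (D : Literature.Probability.RandomPlanarGeometry.DobrushinDomain) (a b : ℝ → Literature.Probability.LatticeModels.Site 2), Literature.Probability.RandomPlanarGeometry.SAW.IsEndpointApprox D a b → ∃ δ₀ : ℝ, 0 < δ₀ ∧ MeasureTheory.IsTightMeasureSet ((fun δ => (Literature.Probability.RandomPlanarGeometry.SAW.law D.carrier δ (a δ) (b δ)).map (fun γ => γ.curve)) '' Set.Ioc 0 δ₀)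

/-- item stmt-CriticalPhenomena-1373 · support · rank 9 · closed · proved by Summit.CriticalPhenomena.SAWScalingLimit.Theorems.AvoidanceDeterminesLaw.AvoidanceDeterminesLaw_proof (prover) · by planner
sources: LawlerSchrammWerner2003Restriction, AizenmanBurchardDuke1999
[support] avoidance determines the law: two probability measures on CurveClass ℂ carried by SIMPLE
chords of the Dobrushin domain D from a to b meeting ∂D only at a, b, which give the same mass to
{range ⊆ closure D'} for every Dobrushin D' ⊆ D with the same marked points and agreeing with D near
a and b (the form delivered by AvoidanceCocycleLimit), are equal (π-system of filled hull
complements generating the Borel sets of simple boundary-avoiding chords: a simple chord is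
determined by its range; Lusin–Souslin for γ ↦ range). Planar-topology/measure-theory analogue of
LSW03 §3 ('the law of K is determined by P[K ∩ A = ∅]'); used for uniqueness of subsequential SAW
limits and for uniqueness of the restriction extension to slit domains. Sources:
LawlerSchrammWerner2003Restriction §3, AizenmanBurchard1999 §2.1. -/
@[route_item "route-CriticalPhenomena-SAWSteinDefect", crux]
def AvoidanceDeterminesLaw : Prop :=
  ∀ (D : Literature.Probability.RandomPlanarGeometry.DobrushinDomain) (μ ν : MeasureTheory.Measure (Literature.Probability.RandomPlanarGeometry.CurveClass ℂ)), MeasureTheory.IsProbabilityMeasure μ → MeasureTheory.IsProbabilityMeasure ν → (∀ᵐ γ ∂μ, γ ∈ Literature.Probability.RandomPlanarGeometry.CurveClass.simple ∧ γ.source = D.pt 0 ∧ γ.target = D.pt 1 ∧ γ.range ⊆ closure D.carrier ∧ γ.range ∩ frontier D.carrier ⊆ {D.pt 0, D.pt 1}) → (∀ᵐ γ ∂ν, γ ∈ Literature.Probability.RandomPlanarGeometry.CurveClass.simple ∧ γ.source = D.pt 0 ∧ γ.target = D.pt 1 ∧ γ.range ⊆ closure D.carrier ∧ γ.range ∩ frontier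 D.carrier ⊆ {D.pt 0, D.pt 1}) → (∀ D' : Literature.Probability.RandomPlanarGeometry.DobrushinDomain, D'.carrier ⊆ D.carrier → D'.pt 0 = D.pt 0 → D'.pt 1 = D.pt 1 → (∃ ε : ℝ, 0 < ε ∧ D'.carrier ∩ Metric.ball (D.pt 0) ε = D.carrier ∩ Metric.ball (D.pt 0) ε ∧ D'.carrier ∩ Metric.ball (D.pt 1) ε = D.carrier ∩ Metric.ball (D.pt 1) ε) → μ (Literature.Probability.RandomPlanarGeometry.CurveClass.rangeSubset (closure D'.carrier)) = ν (Literature.Probability.RandomPlanarGeometry.CurveClass.rangeSubset (closure D'.carrier))) → μ = ν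

/-- `AvoidanceDeterminesLaw` holds: proved by `Summit.CriticalPhenomena.SAWScalingLimit.Theorems.AvoidanceDeterminesLaw.AvoidanceDeterminesLaw_proof`. -/
theorem AvoidanceDeterminesLaw_holds : AvoidanceDeterminesLaw := _root_.Summit.CriticalPhenomena.SAWScalingLimit.Theorems.AvoidanceDeterminesLaw.AvoidanceDeterminesLaw_proof

/-- item stmt-CriticalPhenomena-4981 · support · rank 9 · open · by planner
sources: LawlerSchrammWerner2004SAW, LawlerSchrammWerner2003Restriction, KennedyLawler2013, DyhrGilbertKennedyLawlerPasson2011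
[crux] (A) above — the n = 0 endpoint and typed face of the continuation: for every Dobrushin D,
hull subdomain D' (same marked points, agreeing with D in balls around a and b), endpoint
approximation (a_δ, b_δ), chordal uniformizing φ : ℍ → D and restriction data (Φ, d = Φ'_A(0)) of A
= φ.pullbackHull D', P_δ(range γ_δ ⊆ closure D') → d^(5/8) as δ → 0+ (ENNReal.ofReal). Lattice
meaning: Z_0(Ω'_δ; a,b)/Z_0(Ω_δ; a,b) up to walks touching ∂D' ∩ D (expected o(1); part of the crux)
and largest-component bookkeeping. Value-ful strengthening of
SAWRestrictionRigidity.AvoidanceCocycleLimit (stmt-CriticalPhenomena-1369, value-free); LSW04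
Prediction (restriction exponent 5/8). Delivered in this route by IsingBoundaryRatio → IsingWindow →
FugacityAnalyticity (layer 2, see Two-layer plan); directly attackable too. [deps:
IsingBoundaryRatio] [difficulty: open-problem] -/
@[route_item "route-CriticalPhenomena-SAWSteinDefect", crux]
def AvoidanceLimit : Prop :=
  ∀ (D D' : Literature.Probability.RandomPlanarGeometry.DobrushinDomain) (a b : ℝ → Literature.Probability.LatticeModels.Site 2), Literature.Probability.RandomPlanarGeometry.SAW.IsEndpointApprox D a b → D'.carrier ⊆ D.carrier → D'.pt 0 = D.pt 0 → D'.pt 1 = D.pt 1 → (∃ ε : ℝ, 0 < ε ∧ D'.carrier ∩ Metric.ball (D.pt 0) ε = D.carrier ∩ Metric.ball (D.pt 0) ε ∧ D'.carrier ∩ Metric.ball (D.pt 1) ε = D.carrier ∩ Metric.ball (D.pt 1) ε) → ∀ (φ : Literature.Probability.RandomPlanarGeometry.ConformalEquiv UpperHalfPlane.upperHalfPlaneSet D.carrier), D.IsChordalUniformizing φ → ∀ (Φ : Literature.Probability.RandomPlanarGeometry.ConformalEquiv (UpperHalfPlane.upperHalfPlaneSet \ φ.pullbackHull D') UpperHalfPlane.upperHalfPlaneSet)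 (d : ℝ), Literature.Probability.RandomPlanarGeometry.IsRestrictionMap (φ.pullbackHull D') Φ → Literature.Probability.RandomPlanarGeometry.HasRestrictionDeriv (φ.pullbackHull D') Φ d → Filter.Tendsto (fun δ => ((Literature.Probability.RandomPlanarGeometry.SAW.law D.carrier δ (a δ) (b δ)).map (fun γ => γ.curve)) (Literature.Probability.RandomPlanarGeometry.CurveClass.rangeSubset (closure D'.carrier))) (nhdsWithin 0 (Set.Ioi 0)) (nhds (ENNReal.ofReal (d ^ ((5 : ℝ) / 8))))

/-- item stmt-CriticalPhenomena-4984 · support · rank 9 · closed · proved by Summit.CriticalPhenomena.SAWScalingLimit.Theorems.avoidancePassage_proof @ e48fe0a81c9f (prover) · by planner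
sources: LawlerSchrammWerner2003Restriction, AizenmanBurchardDuke1999
[support] portmanteau sandwich: if ν is the weak limit of the pushed-forward SAW laws along s_n →
0+, μ is the chordal SLE_(8/3) law of D, and along s_n the SAW avoidance probabilities of EVERY hull
subdomain D'' converge to μ(range ⊆ closure D''), then ν(range ⊆ closure D') = μ(range ⊆ closure D')
for every hull subdomain D'. '≥': the event is closed (CurveClass.isClosed_rangeSubset). '≤':
approximate D' from outside by hull super-domains D'_k ⊇ (neighbourhood of cl D') ∩ D with cl D'_k ↓
cl D' (pull back to ℍ: shrink the *-hull A inside its inner parallel sets and re-attach to ℝ), use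
open events rangeSubset(U_k) (isOpen_rangeSubset), lattice curves live in cl D, and continuity from
above of μ (or kernel continuity of Φ'_A(0), LSWConverges.tendsto_restrictionDeriv). Planar topology
+ measure theory; provable now. [difficulty: M] -/
@[route_item "route-CriticalPhenomena-SAWSteinDefect", crux]
def AvoidancePassage : Prop :=
  ∀ (D : Literature.Probability.RandomPlanarGeometry.DobrushinDomain) (a b : ℝ → Literature.Probability.LatticeModels.Site 2), Literature.Probability.RandomPlanarGeometry.SAW.IsEndpointApprox D a b → ∀ (s : ℕ → ℝ) (ν μ : MeasureTheory.Measure (Literature.Probability.RandomPlanarGeometry.CurveClass ℂ)), Filter.Tendsto s Filter.atTop (nhdsWithin 0 (Set.Ioi 0)) → MeasureTheory.IsProbabilityMeasure ν → (∀ f : BoundedContinuousFunction (Literature.Probability.RandomPlanarGeometry.CurveClass ℂ) ℝ, Filter.Tendsto (fun n => ∫ γ, f γ.curve ∂(Literature.Probability.RandomPlanarGeometry.SAW.law D.carrier (s n) (a (s n)) (b (s n)))) Filter.atTop (nhds (∫ x, f x ∂ν))) → Literature.Probability.RandomPlanarGeometry.IsSLELaw ((8 : NNReal) / 3) D μ →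 (∀ D' : Literature.Probability.RandomPlanarGeometry.DobrushinDomain, D'.carrier ⊆ D.carrier → D'.pt 0 = D.pt 0 → D'.pt 1 = D.pt 1 → (∃ ε : ℝ, 0 < ε ∧ D'.carrier ∩ Metric.ball (D.pt 0) ε = D.carrier ∩ Metric.ball (D.pt 0) ε ∧ D'.carrier ∩ Metric.ball (D.pt 1) ε = D.carrier ∩ Metric.ball (D.pt 1) ε) → Filter.Tendsto (fun n => ((Literature.Probability.RandomPlanarGeometry.SAW.law D.carrier (s n) (a (s n)) (b (s n))).map (fun γ => γ.curve)) (Literature.Probability.RandomPlanarGeometry.CurveClass.rangeSubset (closure D'.carrier))) Filter.atTop (nhds (μ (Literature.Probability.RandomPlanarGeometry.CurveClass.rangeSubset (closure D'.carrier))))) → ∀ D' : Literature.Probability.RandomPlanarGeometry.DobrushinDomain, D'.carrier ⊆ D.carrier → D'.pt 0 = D.pt 0 → D'.pt 1 = D.pt 1 → (∃ ε : ℝ, 0 < ε ∧ D'.carrier ∩ Metric.ball (D.pt 0) ε = D.carrier ∩ Metric.ball (D.pt 0) ε ∧ D'.carrier ∩ Metric.ball (D.pt 1) ε = D.carrier ∩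 Metric.ball (D.pt 1) ε) → ν (Literature.Probability.RandomPlanarGeometry.CurveClass.rangeSubset (closure D'.carrier)) = μ (Literature.Probability.RandomPlanarGeometry.CurveClass.rangeSubset (closure D'.carrier))

/-- item stmt-CriticalPhenomena-4985 · support · rank 9 · closed · proved by Summit.CriticalPhenomena.SAWScalingLimit.Theorems.SLECarrier_proof @ 502abaff2cf7 (prover) · by planner
sources: RohdeSchramm2005, LawlerSchrammWerner2003Restriction, Lawler2005
[support] the chordal SLE_(8/3) law of a Dobrushin domain is a probability measure carried by simple
curve classes from a to b with range in closure D meeting ∂D only at a, b (Rohde–Schramm simplicity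
for κ ≤ 4, transience, boundary avoidance; in tree: IsSLELaw.isProbabilityMeasure,
IsSLELaw.ae_simple, IsSLELaw.ae_endpoints, chordalCarrier lemmas, behind the named Rohde–Schramm
facts). Expected to close from the tree. [difficulty: provable-now] -/
@[route_item "route-CriticalPhenomena-SAWSteinDefect", crux]
def SLECarrier : Prop :=
  ∀ (D : Literature.Probability.RandomPlanarGeometry.DobrushinDomain) (μ : MeasureTheory.Measure (Literature.Probability.RandomPlanarGeometry.CurveClass ℂ)), Literature.Probability.RandomPlanarGeometry.IsSLELaw ((8 : NNReal) / 3) D μ → MeasureTheory.IsProbabilityMeasure μ ∧ ∀ᵐ γ ∂μ, γ ∈ Literature.Probability.RandomPlanarGeometry.CurveClass.simple ∧ γ.source = D.pt 0 ∧ γ.target = D.pt 1 ∧ γ.range ⊆ closure D.carrier ∧ γ.range ∩ frontier D.carrier ⊆ {D.pt 0, D.pt 1}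

/-- `SLECarrier` holds: proved by `Summit.CriticalPhenomena.SAWScalingLimit.Theorems.SLECarrier_proof` @ 502abaff2cf7. -/
theorem SLECarrier_holds : SLECarrier := _root_.Summit.CriticalPhenomena.SAWScalingLimit.Theorems.SLECarrier_proof

/-- item stmt-CriticalPhenomena-4986 · support · rank 9 · closed · proved by Summit.CriticalPhenomena.SAWScalingLimit.Theorems.SLEAvoidanceValue_pullbackHull_proof @ 20a055b94c44 (prover) · by planner
sources: LawlerSchrammWerner2003Restriction
[support] LSW03 Thm 6.1 transposed to hull subdomains in the ε-ball form used here: for μ the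
chordal SLE_(8/3) law of D, D' ⊆ D agreeing with D near a, b, φ chordal uniformizing, Φ the
restriction map of A = φ.pullbackHull D' with derivative d, μ(range ⊆ closure D') = ofReal(d^(5/8))
(in tree: sle_restriction_eightThirds_holds + HullRestrictionNull '{Γ ⊆ cl D'} and {γ ∩ A = ∅} agree
a.s.' + IsStarHull.pullbackHull). Expected to close from the tree. [difficulty: provable-now] -/
@[route_item "route-CriticalPhenomena-SAWSteinDefect", crux]
def SLEAvoidanceValue : Prop :=
  ∀ (D D' : Literature.Probability.RandomPlanarGeometry.DobrushinDomain) (μ : MeasureTheory.Measure (Literature.Probability.RandomPlanarGeometry.CurveClass ℂ)), Literature.Probability.RandomPlanarGeometry.IsSLELaw ((8 : NNReal) / 3) D μ → D'.carrier ⊆ D.carrier → D'.pt 0 = D.pt 0 → D'.pt 1 = D.pt 1 → (∃ ε : ℝ, 0 < ε ∧ D'.carrier ∩ Metric.ball (D.pt 0) ε = D.carrier ∩ Metric.ball (D.pt 0) ε ∧ D'.carrier ∩ Metric.ball (D.pt 1) ε = D.carrier ∩ Metric.ball (D.pt 1) ε) → ∀ (φ : Literature.Probability.RandomPlanarGeometry.ConformalEquiv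 UpperHalfPlane.upperHalfPlaneSet D.carrier), D.IsChordalUniformizing φ → ∀ (Φ : Literature.Probability.RandomPlanarGeometry.ConformalEquiv (UpperHalfPlane.upperHalfPlaneSet \ φ.pullbackHull D') UpperHalfPlane.upperHalfPlaneSet) (d : ℝ), Literature.Probability.RandomPlanarGeometry.IsRestrictionMap (φ.pullbackHull D') Φ → Literature.Probability.RandomPlanarGeometry.HasRestrictionDeriv (φ.pullbackHull D') Φ d → μ (Literature.Probability.RandomPlanarGeometry.CurveClass.rangeSubset (closure D'.carrier)) = ENNReal.ofReal (d ^ ((5 : ℝ) / 8))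

/-- item stmt-CriticalPhenomena-7520 · support · rank 9 · open · by planner
sources: LawlerSchrammWerner2004SAW, Lawler2005ConformallyInvariant, Chatterjee2006
[support] the exact Stein/Dynkin identity in terminal-value form: eventually in δ, P_δ(range γ ⊆ cl
D') = E_δ[q_N^{5/8}] (the terminal value q_N^{5/8} is the avoidance indicator: H = H' = 1 at the tip
b_δ once δ·b_δ ∈ D', and the past indicator is the event), so that by finite telescoping P_δ(avoid)
= q_0^{5/8} + E_δ Σ_{n<N}(q_{n+1}^{5/8} − q_n^{5/8}) = q_0^{5/8} + (balance sum) + (remainder sum)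
identically. Finite sums on a finite probability space; first-step bookkeeping only. Checked
numerically to 1e-6 by exact enumeration (5×3 … 7×5 boxes, this seat). [difficulty: provable-now] -/
@[route_item "route-CriticalPhenomena-SAWSteinDefect", crux]
def DefectIdentity : Prop :=
  ∀ (D D' : Literature.Probability.RandomPlanarGeometry.DobrushinDomain) (a b : ℝ → Literature.Probability.LatticeModels.Site 2), let H : ℝ → List (Literature.Probability.LatticeModels.Site 2) → Literature.Probability.LatticeModels.Site 2 → ℝ := fun δ S w => ∑' ω : (Literature.Probability.LatticeModels.discreteDomainGraph D.carrier δ).Walk w (b δ), if (∀ v ∈ ω.support.tail, v ∉ S) ∧ b δ ∉ ω.support.dropLast then (1 / 4 : ℝ) ^ ω.length else 0; let H' : ℝ → List (Literature.Probability.LatticeModels.Site 2) → Literature.Probability.LatticeModels.Site 2 → ℝ := fun δ S w => ∑' ω : (Literature.Probability.LatticeModels.discreteDomainGraph D.carrier δ).Walk w (b δ), if (∀ v ∈ ω.support.tail, v ∉ S) ∧ b δ ∉ ω.support.dropLast ∧ Set.range (ω.toCurve (Literature.Probability.LatticeModels.meshPoint δ)) ⊆ closure D'.carrier then (1 / 4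 : ℝ) ^ ω.length else 0; let Q : (δ : ℝ) → Literature.Probability.RandomPlanarGeometry.SAW.DomainSAW D.carrier δ (a δ) (b δ) → ℕ → ℝ := fun δ γ n => if Set.range ((γ.walk.take n).toCurve (Literature.Probability.LatticeModels.meshPoint δ)) ⊆ closure D'.carrier then H' δ (γ.walk.take n).support (γ.walk.getVert n) / H δ (γ.walk.take n).support (γ.walk.getVert n) else 0; Literature.Probability.RandomPlanarGeometry.SAW.IsEndpointApprox D a b → D'.carrier ⊆ D.carrier → D'.pt 0 = D.pt 0 → D'.pt 1 = D.pt 1 → (∃ ε : ℝ, 0 < ε ∧ D'.carrier ∩ Metric.ball (D.pt 0) ε = D.carrier ∩ Metric.ball (D.pt 0) ε ∧ D'.carrier ∩ Metric.ball (D.pt 1) ε = D.carrier ∩ Metric.ball (D.pt 1) ε) → ∀ᶠ δ in nhdsWithin 0 (Set.Ioi 0), ((Literature.Probability.RandomPlanarGeometry.SAW.law D.carrier δ (a δ) (b δ)).map (fun γ => γ.curve)) (Literature.Probability.RandomPlanarGeometry.CurveClass.rangeSubset (closure D'.carrier)) = ENNReal.ofReal (∫ γ, Q δ γ γ.length ^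 ((5 : ℝ) / 8) ∂(Literature.Probability.RandomPlanarGeometry.SAW.law D.carrier δ (a δ) (b δ)))

/-- item stmt-CriticalPhenomena-7521 · support · rank 9 · open · by planner
sources: LawlerSchrammWerner2003Restriction, Chatterjee2006
[support] the layer-1 glue: DefectIdentity → ExcursionInitialValue → BalanceChannel → CubicRemainder
→ AvoidanceLimit. Proof: P_δ(avoid) = ofReal(q_0^{5/8} + balance + remainder) by the identity and
telescoping (linearity of the integral on a finite probability space, q_0 deterministic); the two
sums → 0, q_0 → d and x ↦ x^{5/8}, ofReal are continuous. Bookkeeping only. [difficulty: S] -/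
@[route_item "route-CriticalPhenomena-SAWSteinDefect", crux]
def DefectToAvoidance : Prop :=
  DefectIdentity → ExcursionInitialValue → BalanceChannel → CubicRemainder → AvoidanceLimit

-- earlier Assembly (stmt-CriticalPhenomena-7522, replaced 2026-08-15T16:22:02Z -> stmt-CriticalPhenomena-10724): retired by None — Literature.Probability.RandomPlanarGeometry.CurveClass.polishSpace (E := ℂ) → Literature.Probability.RandomPlanarGeometry.IsSLECurve.map_eq → Literature.Probability.RandomPlanarGeometry.exists_isSLECurve → Literature.Probability.RandomPlanarGeometry.MarkedDomain.exists_i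
/-- item stmt-CriticalPhenomena-10724 · assembly · rank 1 · closed · proved by Summit.CriticalPhenomena.SAWScalingLimit.Theorems.Assembly_proof (prover) · by planner
sources: LawlerSchrammWerner2003Restriction, LawlerSchrammWerner2004SAW, KemppainenSmirnov2017
[assembly] SLECarrier → SLEAvoidanceValue → AvoidanceLimit → EventualTight → SimpleSubseqLimits →
AvoidancePassage → AvoidanceDeterminesLaw → SAWScalingLimit — the restriction tail shared verbatim
with SAWLoopFugacityFlow (its Assembly stmt-CriticalPhenomena-4988 minus the four Literature
antecedents); in the deciding theorem `closes` the antecedent AvoidanceLimit is produced by the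
layer-1 glue DefectToAvoidance from DefectIdentity, ExcursionInitialValue, BalanceChannel,
CubicRemainder, so every crux of the thesis is load-bearing. The four Literature antecedents of rev
0 (CurveClass.polishSpace, IsSLECurve.map_eq, exists_isSLECurve,
MarkedDomain.exists_isChordalUniformizing) are removed from the STATEMENT because the tree PROVES
what the argument consumes: CurveClass.polishSpace_holds (CurveSpace), IsSLECurve.map_eq_holds
(SLEUniquenessInLaw), exists_isSLECurve_eightThirds (SLEExistenceNeEightHolds — the all-κ fact
exists_isSLECurve is equivalent to the open SLE₈ trace theorem and is NOT needed at κ = 8/3),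
MarkedDomain.exists_isChordalUniformizing_holds (CaratheodoryHalfPlaneProofs); the ∀(φ, Φ,
d)-quantified items instantiate through IsStarHull.pullbackHull with JordanDomain.isS -/
@[route_item "route-CriticalPhenomena-SAWSteinDefect", crux]
def Assembly : Prop :=
  SLECarrier → SLEAvoidanceValue → AvoidanceLimit → EventualTight → SimpleSubseqLimits → AvoidancePassage → AvoidanceDeterminesLaw → SAWScalingLimit

/-! D-0027 §2.1 — DECIDING THEOREM (planner-authored via `route open/edit --closes-file`; by planner-rbadge-CriticalPhenomena-SAWSteinDefec-d929005a-g2-0 2026-08-15T16:53:29Z):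
its hypotheses are this route's items and its conclusion the sub-problem Statement (glue_lint), and it elaborates with this file. -/

@[closes "route-CriticalPhenomena-SAWSteinDefect"] theorem closes (hB : BalanceChannel) (hR : CubicRemainder) (hV : ExcursionInitialValue)
    (hS : SimpleSubseqLimits) (hT : EventualTight) (hADL : AvoidanceDeterminesLaw)
    (_hAL : AvoidanceLimit) (hAP : AvoidancePassage) (hCar : SLECarrier) (hSAV : SLEAvoidanceValue)
    (hDI : DefectIdentity) (hD2A : DefectToAvoidance) (hA : Assembly) :
    _root_.SAWScalingLimit :=
  hA hCar hSAV (hD2A hDI hV hB hR) hT hS hAP hADL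

end Summit.CriticalPhenomena.SAWScalingLimit.Theses.SAWSteinDefect
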